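import Literature.Geometry.Kaehler.FubiniStudyProjectiveSpace
import Literature.Geometry.Kaehler.ProjectiveAffineChartDeriv
import Literature.AlgebraicTopology.CharacteristicClasses.ProjectiveBundleLine
import Literature.AlgebraicTopology.CharacteristicClasses.TautologicalGysin
import Literature.AlgebraicTopology.CharacteristicClasses.RealificationPontryaginClasses
import Literature.Geometry.Symplectic.SymplecticSplittingIso
import Mathlib.Geometry.Manifold.ContMDiffMFDeriv
import Mathlib.Geometry.Manifold.MFDeriv.SpecificFunctions
import HarnessLib

/-!
# The Euler sequence of `ℂℙ²` as a real bundle isomorphism `Tℂℙ² ⊕ ℂ ≅ (γ¹)³`, and `p₁(ℂℙ²) = 3x²`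

J. Milnor, J. Stasheff, *Characteristic Classes* (1974): **Thm. 14.10** (the tangent bundle `τ` of
`ℂPⁿ` satisfies `τ ⊕ ε¹ ≅ γ̄¹ ⊕ ⋯ ⊕ γ̄¹` (`n + 1` summands): a tangent vector at `[v]` is the
image under `d(v ↦ [v])` of a vector of `ℂⁿ⁺¹`, i.e. of a linear map `L → ℂⁿ⁺¹` on the line `L`,
and the kernel is the line direction) and **Example 15.6** (`p(ℂPⁿ) = (1 + a²)ⁿ⁺¹`, hence
`p₁(ℂP²) = 3a²`); F. Hirzebruch, *Topological Methods in Algebraic Geometry* (1966), Thm. 4.10.2;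
P. Griffiths, J. Harris, *Principles of Algebraic Geometry*, Ch. 3 §3 (Euler sequence
`0 → 𝒪 → 𝒪(1)^{⊕(n+1)} → Tℙⁿ → 0`).

Everything here is about the manifold `ComplexProjectiveSpace n` of the tree
(`Literature/Topology/FourManifolds/ComplexProjectiveSpace.lean`, real charts `affineChart i` on
`EuclideanSpace ℝ (Fin (2 n))`) with the class map `toCP : ℂⁿ⁺¹ → ℂℙⁿ` and the canonical lifts
`homLift i` of `FubiniStudyProjectiveSpace.lean`.  We only need — and only prove — a REAL
isomorphism, for which the Hermitian metric identifies `γ¹` with `γ̄¹ = (γ¹)*` and no sign or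
orientation question arises.  Contents (all proved, no named facts):

* `VectorBundle.restrictScalars_real` — the real vector bundle underlying a complex vector bundle
  (Mathlib has no restriction of scalars for `VectorBundle`);
* `toCPDeriv`, `hasMFDerivAt_toCP`, `mfderiv_toCP` — the differential of the class map in the
  preferred affine chart (the quotient rule `qchartDeriv` of `ProjectiveAffineChartDeriv.lean`);
  `mfderiv_toCP_eq_zero_iff` — **its kernel is the line `ℂ v`**; `mfderiv_toCP_smul` —
  `d[·]_{cv}(c w) = d[·]_v(w)`;
* `tautLine n`, `tautLineBundle n` — the tautological line bundle `γ¹` over the manifold `ℂℙⁿ`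
  (the tree's `projTautologicalLineBundle (ℂⁿ⁺¹)` over the definitionally equal base
  `ℙ ℂ (ℂⁿ⁺¹)`, with its instances re-keyed, and the real structure);
* `eulerFib v` — the Euler map `w ↦ (d[·]_v w, ⟨v, w⟩/‖v‖²)`, homogeneous of degree `0` in
  `(v, w)` (`eulerFib_smul`) with trivial kernel (`eulerFib_eq_zero_iff`); `coeffVec`, `eulerRep`,
  `eulerAt`, and **`eulerEquiv p : (γ¹_p)³ ≃L[ℝ] T_pℂℙ² × ℂ`** (injective between real
  `6`-dimensional spaces);
* `continuous_eulerTotal` (through the tangent map of the class map on `ℂ³ ∖ 0` applied to the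
  continuous section `(homLift i, coeffVec)`), `continuous_eulerTotal_symm` (Husemoller Ch. 3
  Thm. 2.5, the tree's `continuous_totalSpace_symm`): **`Tℂℙ² ⊕ ℂ ≅ (γ¹)³` as real vector
  bundles**;
* `chernClassZ_two_directSum` (`c₂(ξ ⊕ η) = c₂ξ + c₁ξ c₁η + c₂η`), `c((γ¹)³) = (1 + x)³` in degrees
  `≤ 2`, and **`tangentPontryaginClass_one_complexProjectiveSpace_two`**:
  `p₁(Tℂℙ²) = 3 x²` in `H⁴(ℂℙ²; ℤ)` (`x = c₁(γ¹)`), by stability `p₁(T ⊕ ε) = p₁(T)`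
  (`PontryaginClassStability.lean`) and the realification formula `p₁(V) = c₁(E)² - 2 c₂(E)` for
  `V ≅_ℝ E` (`RealificationPontryaginClasses.lean`): `(3x)² - 2·3x² = 3x²`.

## References

* J. Milnor, J. Stasheff, *Characteristic Classes*, Ann. of Math. Stud. 76 (1974), §14 Thm. 14.10,
  §15 Example 15.6. [MilnorStasheffAMS76]
* F. Hirzebruch, *Topological Methods in Algebraic Geometry*, 3rd ed. (1966), Thm. 4.10.2.
  [Hirzebruch1966]
* P. Griffiths, J. Harris, *Principles of Algebraic Geometry* (1978), Ch. 0 §2, Ch. 3 §3.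
  [GriffithsHarrisPrinciples1978]
* D. Husemoller, *Fibre Bundles*, 3rd ed. (1994), Ch. 3 Thm. 2.5. [HusemollerFibreBundles1994]
-/

noncomputable section

open scoped ComplexConjugate ContDiff Topology Manifold
open Complex Bundle Set Filter Function

namespace Literature.Geometry.Kaehler

open Literature.Topology.FourManifolds Literature.Topology.FourManifolds.ComplexProjectiveSpace

/-- Local notation: the Hermitian model `ℂⁿ⁺¹`. -/
local notation "𝕎 " n:arg => EuclideanSpace ℂ (Fin (n + 1))
/-- Local notation: the real model space `ℝᵐ`. -/
local notation "𝔼 " m:arg => EuclideanSpace ℝ (Fin m)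

/-! ### Real vector bundle structure underlying a complex vector bundle -/

section RestrictScalars

variable {B : Type*} [TopologicalSpace B] {F : Type*} [NormedAddCommGroup F] [NormedSpace ℂ F]
  [NormedSpace ℝ F] [IsScalarTower ℝ ℂ F]
  {E : B → Type*} [TopologicalSpace (TotalSpace F E)] [∀ b, AddCommMonoid (E b)] [∀ b, Module ℂ (E b)]
  [∀ b, Module ℝ (E b)] [∀ b, IsScalarTower ℝ ℂ (E b)]
  [∀ b, TopologicalSpace (E b)] [FiberBundle F E]

omit [∀ b, TopologicalSpace (E b)] [FiberBundle F E] in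
/-- A complex-linear trivialization is real-linear. [folklore] -/
theorem _root_.Bundle.Trivialization.isLinear_real_of_complex (e : Trivialization F (π F E)) [e.IsLinear ℂ] :
    e.IsLinear ℝ := by
  refine ⟨fun b hb ↦ ⟨fun x y ↦ (e.linear ℂ hb).map_add x y, fun r x ↦ ?_⟩⟩
  rw [← algebraMap_smul ℂ r x, (e.linear ℂ hb).map_smul, algebraMap_smul]

/-- **The real vector bundle underlying a complex vector bundle** (restriction of scalars along
`ℝ ⊂ ℂ`: the same trivializations, real-linear, with the same — continuous — transition
functions). [cite: MilnorStasheffAMS76, §14 p. 155 (the underlying real bundle ω_ℝ)] -/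
theorem _root_.VectorBundle.restrictScalars_real [VectorBundle ℂ F E] : VectorBundle ℝ F E := by
  have hlin : ∀ (e : Trivialization F (π F E)) [MemTrivializationAtlas e], e.IsLinear ℝ :=
    fun e _ ↦ e.isLinear_real_of_complex
  refine ⟨hlin, fun e e' he he' ↦ ?_⟩
  have hc := continuousOn_coordChange ℂ e e'
  have h2 : ContinuousOn (fun b ↦ (Trivialization.coordChangeL ℂ e e' b : F →L[ℂ] F).restrictScalars ℝ)
      (e.baseSet ∩ e'.baseSet) :=
    (ContinuousLinearMap.restrictScalarsIsometry ℂ F F ℝ ℝ).continuous.comp_continuousOn hc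
  refine h2.congr fun b hb ↦ ?_
  ext y
  change Trivialization.coordChangeL ℝ e e' b y = Trivialization.coordChangeL ℂ e e' b y
  rw [Trivialization.coordChangeL_apply' _ _ hb, Trivialization.coordChangeL_apply' _ _ hb]

end RestrictScalars

/-! ### The differential of the class map `v ↦ [v]` and its kernel -/

section ClassMap

variable {n : ℕ}

/-- The coordinate map `ℂⁿ⁺¹ (Hermitian model) → ℂⁿ⁺¹ (product)`, real-linear. [folklore] -/
def ofLpCLM (n : ℕ) : 𝕎 n →L[ℝ] (Fin (n + 1) → ℂ) :=
  ((EuclideanSpace.equiv (Fin (n + 1)) ℂ : 𝕎 n ≃L[ℂ] (Fin (n + 1) → ℂ)) :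
    𝕎 n →L[ℂ] (Fin (n + 1) → ℂ)).restrictScalars ℝ

/-- `ofLpCLM` is the coordinate map. [folklore] -/
@[simp] theorem ofLpCLM_apply (v : 𝕎 n) : ofLpCLM n v = WithLp.ofLp v := rfl

/-- **The differential of the class map at `v`, in the preferred affine chart `k = chartIndex [v]`:
`w ↦ ((w_{k⁺j} v_k - v_{k⁺j} w_k) / v_k²)ⱼ`** (realified; the quotient rule). [folklore] -/
def toCPDeriv (v : 𝕎 n) : 𝕎 n →L[ℝ] 𝔼 (2 * n) :=
  ((realCoordinates n : (Fin n → ℂ) →L[ℝ] 𝔼 (2 * n)).comp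
    ((qchartDeriv (chartIndex (toCP v)) (WithLp.ofLp v)).restrictScalars ℝ)).comp (ofLpCLM n)

/-- `toCPDeriv` evaluated. [folklore] -/
theorem toCPDeriv_apply (v w : 𝕎 n) :
    toCPDeriv v w = realCoordinates n (qchartDeriv (chartIndex (toCP v)) (WithLp.ofLp v) (WithLp.ofLp w)) := rfl

/-- **The class map has differential `toCPDeriv v` at `v ≠ 0`.** [cite: GriffithsHarrisPrinciples1978, Ch. 0 §2] -/
theorem hasMFDerivAt_toCP {v : 𝕎 n} (hv : v ≠ 0) :
    HasMFDerivAt 𝓘(ℝ, 𝕎 n) (𝓡 (2 * n)) (toCP (n := n)) v (toCPDeriv v) := by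
  refine ⟨continuousAt_toCP hv, ?_⟩
  set k := chartIndex (toCP v) with hk_def
  have hk : v k ≠ 0 := (coordNeZero_toCP_iff hv _).1 (coordNeZero_chartIndex _)
  have hev : writtenInExtChartAt 𝓘(ℝ, 𝕎 n) (𝓡 (2 * n)) v (toCP (n := n)) =ᶠ[𝓝 v]
      fun u : 𝕎 n ↦ realCoordinates n (fun j ↦ u (k.succAbove j) / u k) := by
    filter_upwards [affineChart_toCP_eventuallyEq hk] with u hu
    simp only [writtenInExtChartAt, Function.comp_apply, extChartAt_coe, modelWithCornersSelf_coe,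
      id_eq, chartAt_eq, extChartAt_model_space_eq_id, PartialEquiv.refl_symm, PartialEquiv.refl_coe]
    exact hu
  have h1 : HasFDerivAt (fun u : 𝕎 n ↦ WithLp.ofLp u) (ofLpCLM n) v := (ofLpCLM n).hasFDerivAt
  have h2 : HasFDerivAt (qchart k) ((qchartDeriv k (WithLp.ofLp v)).restrictScalars ℝ) (WithLp.ofLp v) :=
    (hasFDerivAt_qchart k hk).restrictScalars ℝ
  have h3 := (realCoordinates n).hasFDerivAt.comp v (h2.comp v h1)
  have h4 : HasFDerivAt (fun u : 𝕎 n ↦ realCoordinates n (fun j ↦ u (k.succAbove j) / u k)) (toCPDeriv v) v := h3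
  have hpt : extChartAt 𝓘(ℝ, 𝕎 n) v v = v := by simp
  rw [hpt]
  exact (h4.congr_of_eventuallyEq hev).hasFDerivWithinAt

/-- `d(toCP)_v = toCPDeriv v`. [folklore] -/
theorem mfderiv_toCP {v : 𝕎 n} (hv : v ≠ 0) :
    mfderiv 𝓘(ℝ, 𝕎 n) (𝓡 (2 * n)) (toCP (n := n)) v = toCPDeriv v :=
  (hasMFDerivAt_toCP hv).mfderiv

/-- The kernel of `toCPDeriv v` is the complex line `ℂ v`. [folklore] -/
theorem toCPDeriv_eq_zero_iff {v : 𝕎 n} (hv : v ≠ 0) (w : 𝕎 n) :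
    toCPDeriv v w = 0 ↔ ∃ c : ℂ, w = c • v := by
  have hk : v (chartIndex (toCP v)) ≠ 0 := (coordNeZero_toCP_iff hv _).1 (coordNeZero_chartIndex _)
  rw [toCPDeriv_apply, map_eq_zero_iff _ (realCoordinates n).injective, qchartDeriv_eq_zero_iff _ hk]
  constructor
  · rintro ⟨c, hc⟩
    exact ⟨c, by rw [← WithLp.toLp_ofLp (p := 2) w, hc, WithLp.toLp_smul, WithLp.toLp_ofLp]⟩
  · rintro ⟨c, rfl⟩
    exact ⟨c, by rw [WithLp.ofLp_smul]⟩

/-- **The kernel of `d[·]_v` is the complex line `ℂ v`** (the fibre direction of `ℂⁿ⁺¹ ∖ 0 → ℂℙⁿ`).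
[cite: GriffithsHarrisPrinciples1978, Ch. 0 §2] -/
theorem mfderiv_toCP_eq_zero_iff {v : 𝕎 n} (hv : v ≠ 0) (w : 𝕎 n) :
    mfderiv 𝓘(ℝ, 𝕎 n) (𝓡 (2 * n)) (toCP (n := n)) v w = 0 ↔ ∃ c : ℂ, w = c • v := by
  rw [mfderiv_toCP hv]
  exact toCPDeriv_eq_zero_iff hv w

/-- `d[·]_v (c v) = 0`. [folklore] -/
theorem mfderiv_toCP_apply_smul_self {v : 𝕎 n} (hv : v ≠ 0) (c : ℂ) :
    mfderiv 𝓘(ℝ, 𝕎 n) (𝓡 (2 * n)) (toCP (n := n)) v (c • v) = 0 :=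
  (mfderiv_toCP_eq_zero_iff hv _).2 ⟨c, rfl⟩

/-- **Homogeneity of the differential of the class map: `d[·]_{cv}(c w) = d[·]_v(w)`** (differentiate
`[c u] = [u]`). [folklore] -/
theorem mfderiv_toCP_smul {v : 𝕎 n} (hv : v ≠ 0) {c : ℂ} (hc : c ≠ 0) (w : 𝕎 n) :
    mfderiv 𝓘(ℝ, 𝕎 n) (𝓡 (2 * n)) (toCP (n := n)) (c • v) (c • w) =
      mfderiv 𝓘(ℝ, 𝕎 n) (𝓡 (2 * n)) (toCP (n := n)) v w := by
  let S : 𝕎 n →L[ℝ] 𝕎 n := c • ContinuousLinearMap.id ℝ (𝕎 n)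
  have hfun : (toCP (n := n)) ∘ S = toCP := by
    funext u
    by_cases hu : u = 0
    · simp [S, hu]
    · exact toCP_smul hc hu
  have hcv : c • v ≠ 0 := smul_ne_zero hc hv
  have hg : MDifferentiableAt 𝓘(ℝ, 𝕎 n) (𝓡 (2 * n)) (toCP (n := n)) (S v) := mdifferentiableAt_toCP hcv
  have hcomp := mfderiv_comp v hg S.hasMFDerivAt.mdifferentiableAt
  rw [hfun, ContinuousLinearMap.mfderiv_eq] at hcomp
  exact (DFunLike.ext_iff.1 hcomp w).symm

end ClassMap


/-! ### The tautological line bundle over the manifold `ℂℙⁿ` -/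

section TautLine

open Literature.AlgebraicTopology.CharacteristicClasses
open scoped LinearAlgebra.Projectivization

variable (n : ℕ)

/-- **The fibres of the tautological line bundle of `ℂℙⁿ`**: over `p` the line `p ⊆ ℂⁿ⁺¹` (the
tree's `tautFiber` over `ℙ ℂ (ℂⁿ⁺¹)`, read over the type synonym `ComplexProjectiveSpace n`, which
carries the manifold structure). [cite: MilnorStasheffAMS76, §14 p. 159 (γ¹(ℂⁿ⁺¹))] -/
abbrev tautLine (p : ComplexProjectiveSpace n) : Type := tautFiber ℂ (Fin (n + 1) → ℂ) p

/-- The topology of the total space of the tautological line bundle of `ℂℙⁿ` (that of the tree's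
`γ¹(ℂⁿ⁺¹) → ℙ(ℂⁿ⁺¹)`; the two quotient topologies on the base agree definitionally). [folklore] -/
instance instTopologicalSpaceTautLineTotal : TopologicalSpace (TotalSpace ℂ (tautLine n)) :=
  instTopologicalSpaceTautTotalSpace ℂ (Fin (n + 1) → ℂ)

/-- The tautological line bundle of `ℂℙⁿ` is a fibre bundle. [folklore] -/
instance instFiberBundleTautLine : FiberBundle ℂ (tautLine n) := instFiberBundleTaut ℂ (Fin (n + 1) → ℂ)

/-- The tautological line bundle of `ℂℙⁿ` is a complex vector bundle. [folklore] -/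
instance instVectorBundleTautLine : VectorBundle ℂ ℂ (tautLine n) := instVectorBundleTaut ℂ (Fin (n + 1) → ℂ)

/-- The tautological line bundle of `ℂℙⁿ` is a real vector bundle (restriction of scalars).
[cite: MilnorStasheffAMS76, §14 p. 155] -/
instance instVectorBundleRealTautLine : VectorBundle ℝ ℂ (tautLine n) := VectorBundle.restrictScalars_real

/-- **The tautological line bundle `γ¹ → ℂℙⁿ`** as a bundled complex line bundle over the manifold
`ComplexProjectiveSpace n`. [cite: MilnorStasheffAMS76, §14 p. 159] -/
def tautLineBundle : ComplexVectorBundle.{0, 0} (ComplexProjectiveSpace n) where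
  F := ℂ
  E := tautLine n

/-- `γ¹ → ℂℙⁿ` is a line bundle. [folklore] -/
@[simp] theorem rank_tautLineBundle : (tautLineBundle n).rank = 1 := Module.finrank_self ℂ

variable {n}

/-- The canonical lift `homLift i p` lies on the line `p` (for `p ∈ Uᵢ`). [folklore] -/
theorem ofLp_homLift_mem {i : Fin (n + 1)} {p : ComplexProjectiveSpace n} (h : CoordNeZero i p) :
    WithLp.ofLp (homLift i p) ∈ Projectivization.submodule (p : ℙ ℂ (Fin (n + 1) → ℂ)) := by
  induction p using ind with
  | h v =>
    have hvi : (v : Fin (n + 1) → ℂ) i ≠ 0 := (coordNeZero_mk i v).1 h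
    change WithLp.ofLp (homLift i (mk v)) ∈ Projectivization.submodule (Projectivization.mk ℂ (v : Fin (n + 1) → ℂ) v.2)
    rw [Projectivization.submodule_mk, homLift_mk, WithLp.ofLp_toLp]
    refine Submodule.mem_span_singleton.2 ⟨((v : Fin (n + 1) → ℂ) i)⁻¹, ?_⟩
    funext j
    simp [div_eq_inv_mul]

/-- Every vector of the line `p` is a complex multiple of a nonzero vector of `p`. [folklore] -/
theorem exists_eq_smul_of_mem {p : ComplexProjectiveSpace n} {v : Fin (n + 1) → ℂ}
    (hv : v ∈ Projectivization.submodule (p : ℙ ℂ (Fin (n + 1) → ℂ))) (hv0 : v ≠ 0) (u : tautLine n p) :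
    ∃ d : ℂ, (u : Fin (n + 1) → ℂ) = d • v := by
  have h1 : Module.finrank ℂ (tautLine n p) = 1 := Projectivization.finrank_submodule _
  obtain ⟨d, hd⟩ := (finrank_eq_one_iff_of_nonzero' (⟨v, hv⟩ : tautLine n p)
    (fun h0 ↦ hv0 (congrArg Subtype.val h0))).1 h1 u
  exact ⟨d, by rw [← hd]; rfl⟩

end TautLine

/-! ### The Euler map on a fibre: `(w, v) ↦ (d[·]_v w, ⟨v, w⟩ / ‖v‖²)` -/

section EulerFibre

open Literature.AlgebraicTopology.CharacteristicClasses
open scoped LinearAlgebra.Projectivization InnerProductSpace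

variable {n : ℕ}

/-- **The Euler map of a representative `v`**: `w ↦ (d[·]_v(w), ⟨v, w⟩ / ‖v‖²) ∈ T_{[v]} ℂℙⁿ × ℂ`
(the differential of the class map together with the coefficient of `w` along `v`), real-linear in
`w` (Milnor–Stasheff Thm. 14.10 / Griffiths–Harris p. 409: the Euler sequence
`0 → ℂ → γ* ⊗ ℂⁿ⁺¹ → Tℂℙⁿ → 0`, split by the Hermitian metric). [cite: MilnorStasheffAMS76, §14 Thm. 14.10] -/
def eulerFib (v : 𝕎 n) : 𝕎 n →L[ℝ] (𝔼 (2 * n) × ℂ) :=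
  (show 𝕎 n →L[ℝ] 𝔼 (2 * n) from mfderiv 𝓘(ℝ, 𝕎 n) (𝓡 (2 * n)) (toCP (n := n)) v).prod
    ((((‖v‖ : ℂ) ^ 2)⁻¹) • (innerSL ℂ v : 𝕎 n →L[ℂ] ℂ).restrictScalars ℝ)

/-- The tangent component of the Euler map. [folklore] -/
theorem eulerFib_apply_fst (v w : 𝕎 n) :
    (eulerFib v w).1 = mfderiv 𝓘(ℝ, 𝕎 n) (𝓡 (2 * n)) (toCP (n := n)) v w := rfl

/-- The scalar component of the Euler map. [folklore] -/
theorem eulerFib_apply_snd (v w : 𝕎 n) : (eulerFib v w).2 = ((‖v‖ : ℂ) ^ 2)⁻¹ * ⟪v, w⟫_ℂ := rfl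

/-- `conj c * c = ‖c‖²` in `ℂ`. [folklore] -/
theorem conj_mul_eq_norm_sq (c : ℂ) : conj c * c = ((‖c‖ : ℂ)) ^ 2 := by
  rw [← Complex.normSq_eq_conj_mul_self, Complex.normSq_eq_norm_sq]; push_cast; ring

/-- **The Euler map is homogeneous of degree `0` in `(v, w)`**: `eulerFib (c v) (c w) = eulerFib v w`
(so it descends to `γ ⊗ ℂⁿ⁺¹`). [cite: MilnorStasheffAMS76, §14 Thm. 14.10] -/
theorem eulerFib_smul {v : 𝕎 n} (hv : v ≠ 0) {c : ℂ} (hc : c ≠ 0) (w : 𝕎 n) :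
    eulerFib (c • v) (c • w) = eulerFib v w := by
  refine Prod.ext ?_ ?_
  · rw [eulerFib_apply_fst, eulerFib_apply_fst]
    exact mfderiv_toCP_smul hv hc w
  · rw [eulerFib_apply_snd, eulerFib_apply_snd, inner_smul_left, inner_smul_right, norm_smul]
    have hcn : (‖c‖ : ℂ) ≠ 0 := by exact_mod_cast norm_ne_zero_iff.2 hc
    have hvn : (‖v‖ : ℂ) ≠ 0 := by exact_mod_cast norm_ne_zero_iff.2 hv
    rw [starRingEnd_apply, show star c * (c * ⟪v, w⟫_ℂ) = (conj c * c) * ⟪v, w⟫_ℂ by rw [mul_assoc]; rfl,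
      conj_mul_eq_norm_sq]
    push_cast
    field_simp

/-- **The kernel of the Euler map is trivial**: `d[·]_v w = 0` forces `w = c v`, and then
`⟨v, w⟩ / ‖v‖² = c`. [cite: MilnorStasheffAMS76, §14 Thm. 14.10] -/
theorem eulerFib_eq_zero_iff {v : 𝕎 n} (hv : v ≠ 0) (w : 𝕎 n) : eulerFib v w = 0 ↔ w = 0 := by
  constructor
  · intro h
    have h1 : mfderiv 𝓘(ℝ, 𝕎 n) (𝓡 (2 * n)) (toCP (n := n)) v w = 0 := by
      rw [← eulerFib_apply_fst, h]; rfl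
    obtain ⟨c, rfl⟩ := (mfderiv_toCP_eq_zero_iff hv w).1 h1
    have h2 : ((‖v‖ : ℂ) ^ 2)⁻¹ * ⟪v, c • v⟫_ℂ = 0 := by rw [← eulerFib_apply_snd, h]; rfl
    rw [inner_smul_right, inner_self_eq_norm_sq_to_K] at h2
    have hvn : (‖v‖ : ℂ) ≠ 0 := by exact_mod_cast norm_ne_zero_iff.2 hv
    have hvn2 : ((‖v‖ : ℂ) ^ 2) ≠ 0 := pow_ne_zero _ hvn
    have hc : c = 0 := by
      rcases mul_eq_zero.1 h2 with h | h
      · exact absurd (inv_eq_zero.1 h) hvn2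
      · exact (mul_eq_zero.1 h).resolve_right hvn2
    rw [hc, zero_smul]
  · rintro rfl
    exact map_zero _

/-- `⟨r x, y⟩ = r ⟨x, y⟩` for real `r`. [folklore] -/
theorem inner_real_smul_left' (r : ℝ) (x y : 𝕎 n) : ⟪r • x, y⟫_ℂ = (r : ℂ) * ⟪x, y⟫_ℂ := by
  rw [RCLike.real_smul_eq_coe_smul (K := ℂ) r x, inner_smul_left]
  simp

/-- **The coefficient vector of a triple of vectors of the line through `v`**:
`(u₀, u₁, u₂) ↦ (⟨u₀, v⟩, ⟨u₁, v⟩, ⟨u₂, v⟩) ∈ ℂ³` (the Hermitian metric identifies `γ` with `γ̄ = γ*`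
real-linearly). [cite: MilnorStasheffAMS76, §14 Thm. 14.10] -/
def coeffVec (v : 𝕎 2) (a : (Fin 3 → ℂ) × ((Fin 3 → ℂ) × (Fin 3 → ℂ))) : 𝕎 2 :=
  WithLp.toLp 2 ![⟪WithLp.toLp 2 a.1, v⟫_ℂ, ⟪WithLp.toLp 2 a.2.1, v⟫_ℂ, ⟪WithLp.toLp 2 a.2.2, v⟫_ℂ]

/-- `coeffVec v` as a real-linear map. [folklore] -/
def coeffVecL (v : 𝕎 2) : ((Fin 3 → ℂ) × ((Fin 3 → ℂ) × (Fin 3 → ℂ))) →L[ℝ] 𝕎 2 where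
  toFun := coeffVec v
  map_add' a b := by
    ext k
    fin_cases k <;> simp [coeffVec]
  map_smul' r a := by
    ext k
    fin_cases k <;> simp [coeffVec, WithLp.toLp_smul, Complex.real_smul]
  cont := by
    unfold coeffVec
    fun_prop

/-- `coeffVecL` is `coeffVec`. [folklore] -/
@[simp] theorem coeffVecL_apply (v : 𝕎 2) (a : (Fin 3 → ℂ) × ((Fin 3 → ℂ) × (Fin 3 → ℂ))) :
    coeffVecL v a = coeffVec v a := rfl

/-- `coeffVec (c v) a = c coeffVec v a`. [folklore] -/
theorem coeffVec_smul (v : 𝕎 2) (c : ℂ) (a : (Fin 3 → ℂ) × ((Fin 3 → ℂ) × (Fin 3 → ℂ))) :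
    coeffVec (c • v) a = c • coeffVec v a := by
  ext k
  fin_cases k <;> simp [coeffVec]

/-- The vectors of a triple of elements of the line `p`. [folklore] -/
def tripleVec {n : ℕ} {p : ComplexProjectiveSpace n} (u : tautLine n p × (tautLine n p × tautLine n p)) :
    (Fin (n + 1) → ℂ) × ((Fin (n + 1) → ℂ) × (Fin (n + 1) → ℂ)) :=
  ((u.1 : Fin (n + 1) → ℂ), ((u.2.1 : Fin (n + 1) → ℂ), (u.2.2 : Fin (n + 1) → ℂ)))

/-- `tripleVec` as a real-linear map. [folklore] -/
def tripleVecL {n : ℕ} (p : ComplexProjectiveSpace n) :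
    (tautLine n p × (tautLine n p × tautLine n p)) →L[ℝ] ((Fin (n + 1) → ℂ) × ((Fin (n + 1) → ℂ) × (Fin (n + 1) → ℂ))) :=
  ((Projectivization.submodule (p : ℙ ℂ (Fin (n + 1) → ℂ))).subtypeL.restrictScalars ℝ).prodMap
    (((Projectivization.submodule (p : ℙ ℂ (Fin (n + 1) → ℂ))).subtypeL.restrictScalars ℝ).prodMap
      ((Projectivization.submodule (p : ℙ ℂ (Fin (n + 1) → ℂ))).subtypeL.restrictScalars ℝ))

/-- `tripleVecL` is `tripleVec`. [folklore] -/
@[simp] theorem tripleVecL_apply {n : ℕ} (p : ComplexProjectiveSpace n) (u : tautLine n p × (tautLine n p × tautLine n p)) :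
    tripleVecL p u = tripleVec u := rfl

/-- **The Euler map of the fibre over `p`, computed with the representative `v ∈ p ∖ 0`**:
`u ↦ eulerFib v (coeffVec v u)`. [cite: MilnorStasheffAMS76, §14 Thm. 14.10] -/
def eulerRep (p : ComplexProjectiveSpace 2) (v : 𝕎 2) :
    (tautLine 2 p × (tautLine 2 p × tautLine 2 p)) →L[ℝ] (𝔼 (2 * 2) × ℂ) :=
  (eulerFib v).comp ((coeffVecL v).comp (tripleVecL p))

/-- `eulerRep` evaluated. [folklore] -/
theorem eulerRep_apply (p : ComplexProjectiveSpace 2) (v : 𝕎 2) (u : tautLine 2 p × (tautLine 2 p × tautLine 2 p)) :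
    eulerRep p v u = eulerFib v (coeffVec v (tripleVec u)) := rfl

/-- **Independence of the representative**: `eulerRep p (c v) = eulerRep p v`. [cite: MilnorStasheffAMS76, §14 Thm. 14.10] -/
theorem eulerRep_smul (p : ComplexProjectiveSpace 2) {v : 𝕎 2} (hv : v ≠ 0) {c : ℂ} (hc : c ≠ 0) :
    eulerRep p (c • v) = eulerRep p v := by
  refine ContinuousLinearMap.ext fun u ↦ ?_
  rw [eulerRep_apply, eulerRep_apply, coeffVec_smul, eulerFib_smul hv hc]

/-- **The Euler map of a fibre is injective** (for a representative `v ∈ p ∖ 0`).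
[cite: MilnorStasheffAMS76, §14 Thm. 14.10] -/
theorem eulerRep_injective (p : ComplexProjectiveSpace 2) {v : 𝕎 2} (hv : v ≠ 0)
    (hvp : WithLp.ofLp v ∈ Projectivization.submodule (p : ℙ ℂ (Fin 3 → ℂ))) : Injective (eulerRep p v) := by
  have hv' : WithLp.ofLp v ≠ 0 := fun h ↦ hv ((ofLp_eq_zero_iff v).1 h)
  refine (injective_iff_map_eq_zero _).2 fun u hu ↦ ?_
  rw [eulerRep_apply, eulerFib_eq_zero_iff hv] at hu
  -- each `⟨u_k, v⟩ = 0`, and `u_k = d_k v`, so `d_k = 0`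
  have hk : ∀ u' : tautLine 2 p, ⟪WithLp.toLp 2 (u' : Fin 3 → ℂ), v⟫_ℂ = 0 → u' = 0 := by
    intro u' h
    obtain ⟨d, hd⟩ := exists_eq_smul_of_mem hvp hv' u'
    have h' : ⟪WithLp.toLp 2 (u' : Fin 3 → ℂ), v⟫_ℂ = conj d * ((‖v‖ : ℂ) ^ 2) := by
      rw [hd, WithLp.toLp_smul, WithLp.toLp_ofLp, inner_smul_left, inner_self_eq_norm_sq_to_K]; rfl
    rw [h'] at h
    have hvn : (‖v‖ : ℂ) ≠ 0 := by exact_mod_cast norm_ne_zero_iff.2 hv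
    have hd0 : d = 0 := by simpa [hvn] using h
    apply Subtype.ext
    rw [hd, hd0, zero_smul]; rfl
  have h0 := congrArg (fun w : 𝕎 2 ↦ w 0) hu
  have h1 := congrArg (fun w : 𝕎 2 ↦ w 1) hu
  have h2 := congrArg (fun w : 𝕎 2 ↦ w 2) hu
  simp only [coeffVec, tripleVec, PiLp.toLp_apply, Matrix.cons_val_zero, Matrix.cons_val_one, Matrix.cons_val,
    PiLp.zero_apply] at h0 h1 h2
  exact Prod.ext (hk _ h0) (Prod.ext (hk _ h1) (hk _ h2))

end EulerFibre


/-! ### The canonical Euler isomorphism of a fibre and the continuity of the total map -/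

section EulerTotal

open Literature.AlgebraicTopology.CharacteristicClasses
open scoped LinearAlgebra.Projectivization InnerProductSpace

variable {n : ℕ}

/-- The fibres of `γ¹ → ℂℙⁿ` are finite-dimensional real vector spaces. [folklore] -/
instance instFiniteDimensionalRealTautLine (p : ComplexProjectiveSpace n) : FiniteDimensional ℝ (tautLine n p) :=
  Module.Finite.trans ℂ (tautLine n p)

/-- `dim_ℝ γ¹_p = 2`. [folklore] -/
theorem finrank_real_tautLine (p : ComplexProjectiveSpace n) : Module.finrank ℝ (tautLine n p) = 2 := by
  rw [← Module.finrank_mul_finrank ℝ ℂ (tautLine n p), Complex.finrank_real_complex,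
    show Module.finrank ℂ (tautLine n p) = 1 from Projectivization.finrank_submodule _]

/-- **The Euler map of the fibre over `p`** (with the preferred representative
`homLift (chartIndex p) p`). [cite: MilnorStasheffAMS76, §14 Thm. 14.10] -/
def eulerAt (p : ComplexProjectiveSpace 2) : (tautLine 2 p × (tautLine 2 p × tautLine 2 p)) →L[ℝ] (𝔼 (2 * 2) × ℂ) :=
  eulerRep p (homLift (chartIndex p) p)

/-- The Euler map of the fibre over `p ∈ Uᵢ` may be computed with the representative `homLift i p`.
[folklore] -/
theorem eulerAt_eq_eulerRep {i : Fin 3} {p : ComplexProjectiveSpace 2} (h : CoordNeZero i p) :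
    eulerAt p = eulerRep p (homLift i p) := by
  have hj := coordNeZero_chartIndex p
  rw [eulerAt, homLift_eq_inv_smul h hj]
  exact (eulerRep_smul p (homLift_ne_zero hj) (inv_ne_zero (homLift_apply_ne_zero h hj))).symm

/-- The Euler map of a fibre is injective. [cite: MilnorStasheffAMS76, §14 Thm. 14.10] -/
theorem eulerAt_injective (p : ComplexProjectiveSpace 2) : Injective (eulerAt p) :=
  eulerRep_injective p (homLift_ne_zero (coordNeZero_chartIndex p)) (ofLp_homLift_mem (coordNeZero_chartIndex p))

/-- `dim_ℝ (γ¹_p)³ = 6 = dim_ℝ (T_p ℂℙ² × ℂ)`. [folklore] -/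
theorem finrank_fibre_eq (p : ComplexProjectiveSpace 2) :
    Module.finrank ℝ (tautLine 2 p × (tautLine 2 p × tautLine 2 p)) = Module.finrank ℝ (𝔼 (2 * 2) × ℂ) := by
  simp only [Module.finrank_prod, finrank_real_tautLine, finrank_euclideanSpace, Fintype.card_fin,
    Complex.finrank_real_complex]

/-- **The Euler isomorphism of the fibre over `p`: `(γ¹_p)³ ≅_ℝ T_p ℂℙ² × ℂ`** (an injective real-linear
map between spaces of the same dimension). [cite: MilnorStasheffAMS76, §14 Thm. 14.10] -/
def eulerEquiv (p : ComplexProjectiveSpace 2) : (tautLine 2 p × (tautLine 2 p × tautLine 2 p)) ≃L[ℝ] (𝔼 (2 * 2) × ℂ) :=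
  (LinearEquiv.ofBijective (eulerAt p).toLinearMap
    ⟨eulerAt_injective p, (LinearMap.injective_iff_surjective_of_finrank_eq_finrank (finrank_fibre_eq p)).1
      (eulerAt_injective p)⟩).toContinuousLinearEquiv

/-- `eulerEquiv` is `eulerAt` on vectors. [folklore] -/
@[simp] theorem eulerEquiv_apply (p : ComplexProjectiveSpace 2) (u : tautLine 2 p × (tautLine 2 p × tautLine 2 p)) :
    eulerEquiv p u = eulerAt p u := rfl

/-- `coeffVec` is jointly continuous. [folklore] -/
theorem continuous_coeffVec₂ : Continuous fun x : 𝕎 2 × ((Fin 3 → ℂ) × ((Fin 3 → ℂ) × (Fin 3 → ℂ))) ↦ coeffVec x.1 x.2 := by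
  unfold coeffVec
  fun_prop

/-- Two points of a tangent bundle with the same vector over equal base points agree (the fibres of
the tangent bundle are all the model space). [folklore] -/
theorem tangentBundle_mk_eq {E' : Type*} [NormedAddCommGroup E'] [NormedSpace ℝ E'] {H' : Type*} [TopologicalSpace H']
    {I' : ModelWithCorners ℝ E' H'} {M' : Type*} [TopologicalSpace M'] [ChartedSpace H' M'] {x y : M'} (h : x = y) (ξ : E') :
    (TotalSpace.mk x ξ : TangentBundle I' M') = TotalSpace.mk y ξ := by
  subst h; rfl

/-- Local notation: the total space of `(γ¹)³ → ℂℙ²`. -/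
local notation "𝕋" => TotalSpace (ℂ × (ℂ × ℂ)) (fun p : ComplexProjectiveSpace 2 ↦ tautLine 2 p × (tautLine 2 p × tautLine 2 p))
/-- Local notation: the total space of `Tℂℙ² ⊕ ℂ`. -/
local notation "𝕍" => TotalSpace (𝔼 (2 * 2) × ℂ)
  (fun p : ComplexProjectiveSpace 2 ↦ TangentSpace (𝓡 (2 * 2)) p × Bundle.Trivial (ComplexProjectiveSpace 2) ℂ p)

/-- **The total Euler map `(γ¹)³ → Tℂℙ² ⊕ ℂ`.** [cite: MilnorStasheffAMS76, §14 Thm. 14.10] -/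
def eulerTotal (q : 𝕋) : 𝕍 := ⟨q.proj, eulerAt q.proj q.snd⟩

/-- The vectors of a point of `(γ¹)³` depend continuously on the point. [folklore] -/
theorem continuous_tripleVec_total : Continuous fun q : 𝕋 ↦ tripleVec q.snd := by
  have hd := (FiberBundle.Prod.isInducing_diag ℂ (tautLine 2) (ℂ × ℂ) (fun p ↦ tautLine 2 p × tautLine 2 p)).continuous
  have hd2 := (FiberBundle.Prod.isInducing_diag ℂ (tautLine 2) ℂ (tautLine 2)).continuous.comp (continuous_snd.comp hd)
  have h1 : Continuous fun q : 𝕋 ↦ ((q.snd.1 : tautLine 2 q.proj) : Fin 3 → ℂ) :=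
    (continuous_tautFiberVec (Fin 3 → ℂ)).comp (continuous_fst.comp hd)
  have h2 : Continuous fun q : 𝕋 ↦ ((q.snd.2.1 : tautLine 2 q.proj) : Fin 3 → ℂ) :=
    (continuous_tautFiberVec (Fin 3 → ℂ)).comp (continuous_fst.comp hd2)
  have h3 : Continuous fun q : 𝕋 ↦ ((q.snd.2.2 : tautLine 2 q.proj) : Fin 3 → ℂ) :=
    (continuous_tautFiberVec (Fin 3 → ℂ)).comp (continuous_snd.comp hd2)
  exact h1.prodMk (h2.prodMk h3)

/-- **Continuity of `x ↦ ([V x], d[·]_{V x}(W x)) ∈ Tℂℙⁿ`** for `V`, `W` continuous at `x₀` and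
`V x₀ ≠ 0`: the tangent map of the class map (smooth off the origin) applied to the continuous section
`(V, W)` of `T(ℂⁿ⁺¹) = ℂⁿ⁺¹ × ℂⁿ⁺¹`. [folklore] -/
theorem continuousAt_mk_mfderiv_toCP {X : Type*} [TopologicalSpace X] {V W : X → 𝕎 n} {x₀ : X}
    (hV : ContinuousAt V x₀) (hW : ContinuousAt W x₀) (h0 : V x₀ ≠ 0) :
    ContinuousAt (fun x ↦ (TotalSpace.mk (toCP (V x)) (mfderiv 𝓘(ℝ, 𝕎 n) (𝓡 (2 * n)) (toCP (n := n)) (V x) (W x)) :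
      TangentBundle (𝓡 (2 * n)) (ComplexProjectiveSpace n))) x₀ := by
  have hS : IsOpen {u : 𝕎 n | u ≠ 0} := isOpen_ne
  have hf : ContMDiffOn 𝓘(ℝ, 𝕎 n) (𝓡 (2 * n)) ∞ (toCP (n := n)) {u : 𝕎 n | u ≠ 0} :=
    fun u hu ↦ (contMDiffAt_toCP hu).contMDiffWithinAt
  have hcont := hf.continuousOn_tangentMapWithin (by simp) hS.uniqueMDiffOn
  have hΦ : ContinuousAt (fun x ↦ ((tangentBundleModelSpaceHomeomorph 𝓘(ℝ, 𝕎 n)).symm (V x, W x) :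
      TangentBundle 𝓘(ℝ, 𝕎 n) (𝕎 n))) x₀ :=
    (tangentBundleModelSpaceHomeomorph 𝓘(ℝ, 𝕎 n)).symm.continuous.continuousAt.comp (hV.prodMk hW)
  have hT' := (hcont.continuousAt ((hS.preimage (FiberBundle.continuous_proj (𝕎 n)
    (TangentSpace 𝓘(ℝ, 𝕎 n)))).mem_nhds (show V x₀ ≠ 0 from h0))).comp hΦ
  refine hT'.congr ?_
  filter_upwards [hV.preimage_mem_nhds (hS.mem_nhds h0)] with x hx
  change (⟨toCP (V x), mfderivWithin 𝓘(ℝ, 𝕎 n) (𝓡 (2 * n)) (toCP (n := n)) {u : 𝕎 n | u ≠ 0} (V x) (W x)⟩ :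
    TangentBundle (𝓡 (2 * n)) (ComplexProjectiveSpace n)) = _
  rw [mfderivWithin_of_isOpen hS hx]

/-- Continuity of `x ↦ (b x, f x)` into a trivial bundle. [folklore] -/
theorem continuousAt_mk_trivial {X : Type*} [TopologicalSpace X] {B' F' : Type*} [TopologicalSpace B'] [TopologicalSpace F']
    {b : X → B'} {f : X → F'} {x₀ : X} (hb : ContinuousAt b x₀) (hf : ContinuousAt f x₀) :
    ContinuousAt (fun x ↦ (TotalSpace.mk (b x) (f x) : TotalSpace F' (Bundle.Trivial B' F'))) x₀ :=
  (Bundle.Trivial.homeomorphProd B' F').symm.continuous.continuousAt.comp (hb.prodMk hf)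

/-- The coefficient vector of a point of `(γ¹)³` over `Uᵢ`, for the representative `homLift i`. [folklore] -/
def coeffAt (i : Fin 3) (q : 𝕋) : 𝕎 2 := coeffVec (homLift i q.proj) (tripleVec q.snd)

/-- The coefficient vector is continuous at the points over `Uᵢ`. [folklore] -/
theorem continuousAt_coeffAt {i : Fin 3} {q₀ : 𝕋} (h : CoordNeZero i q₀.proj) : ContinuousAt (coeffAt i) q₀ := by
  have hproj : Continuous fun q : 𝕋 ↦ q.proj := FiberBundle.continuous_proj (ℂ × (ℂ × ℂ)) _
  have hv : ContinuousAt (fun q : 𝕋 ↦ homLift i q.proj) q₀ :=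
    ((contMDiffOn_homLift i).continuousOn.continuousAt ((isOpen_setOf_coordNeZero i).mem_nhds h)).comp
      hproj.continuousAt
  exact (continuous_coeffVec₂.continuousAt.comp (hv.prodMk continuous_tripleVec_total.continuousAt) :)

/-- The total Euler map over `Uᵢ`, written with the representative `homLift i`. [folklore] -/
theorem eulerTotal_eq {i : Fin 3} {q : 𝕋} (hq : CoordNeZero i q.proj) :
    eulerTotal q = ⟨q.proj, (mfderiv 𝓘(ℝ, 𝕎 2) (𝓡 (2 * 2)) (toCP (n := 2)) (homLift i q.proj) (coeffAt i q),
      ((‖homLift i q.proj‖ : ℂ) ^ 2)⁻¹ * ⟪homLift i q.proj, coeffAt i q⟫_ℂ)⟩ := by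
  change (⟨q.proj, eulerAt q.proj q.snd⟩ : 𝕍) = _
  rw [eulerAt_eq_eulerRep hq]
  rfl

/-- **The total Euler map is continuous.** Near a point over `Uᵢ` it is
`q ↦ (d[·]_{v(q)} w(q), ⟨v q, w q⟩/‖v q‖²)` with `v q = homLift i q` smooth and `w q` the (continuous)
coefficient vector; the first component is the tangent map of the class map applied to the
continuous section `(v, w)` of `Tℂ³`. [cite: MilnorStasheffAMS76, §14 Thm. 14.10] -/
theorem continuous_eulerTotal : Continuous eulerTotal := by
  refine continuous_iff_continuousAt.2 fun q₀ ↦ ?_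
  have hq₀ : CoordNeZero (chartIndex q₀.proj) q₀.proj := coordNeZero_chartIndex _
  have hproj : Continuous fun q : 𝕋 ↦ q.proj := FiberBundle.continuous_proj (ℂ × (ℂ × ℂ)) _
  have hUq : {q : 𝕋 | CoordNeZero (chartIndex q₀.proj) q.proj} ∈ 𝓝 q₀ :=
    ((isOpen_setOf_coordNeZero _).preimage hproj).mem_nhds hq₀
  have hv : ContinuousAt (fun q : 𝕋 ↦ homLift (chartIndex q₀.proj) q.proj) q₀ :=
    ((contMDiffOn_homLift _).continuousOn.continuousAt ((isOpen_setOf_coordNeZero _).mem_nhds hq₀)).comp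
      hproj.continuousAt
  have hw : ContinuousAt (coeffAt (chartIndex q₀.proj)) q₀ := continuousAt_coeffAt hq₀
  have hv0 : homLift (chartIndex q₀.proj) q₀.proj ≠ 0 := homLift_ne_zero hq₀
  -- (a) the tangent component
  have hT : ContinuousAt (fun q : 𝕋 ↦ (TotalSpace.mk q.proj (mfderiv 𝓘(ℝ, 𝕎 2) (𝓡 (2 * 2)) (toCP (n := 2))
      (homLift (chartIndex q₀.proj) q.proj) (coeffAt (chartIndex q₀.proj) q)) :
        TangentBundle (𝓡 (2 * 2)) (ComplexProjectiveSpace 2))) q₀ := by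
    refine (continuousAt_mk_mfderiv_toCP hv hw hv0).congr ?_
    filter_upwards [hUq] with q hq
    exact tangentBundle_mk_eq (toCP_homLift hq) _
  -- (b) the trivial component
  have hZ : ContinuousAt (fun q : 𝕋 ↦ (TotalSpace.mk q.proj (((‖homLift (chartIndex q₀.proj) q.proj‖ : ℂ) ^ 2)⁻¹ *
      ⟪homLift (chartIndex q₀.proj) q.proj, coeffAt (chartIndex q₀.proj) q⟫_ℂ) :
        TotalSpace ℂ (Bundle.Trivial (ComplexProjectiveSpace 2) ℂ))) q₀ := by
    refine continuousAt_mk_trivial hproj.continuousAt ?_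
    have hn : ContinuousAt (fun q : 𝕋 ↦ ((‖homLift (chartIndex q₀.proj) q.proj‖ : ℂ) ^ 2)⁻¹) q₀ := by
      refine ((Complex.continuous_ofReal.continuousAt.comp hv.norm).pow 2).inv₀ ?_
      exact pow_ne_zero _ (by simpa using hv0)
    exact hn.mul (hv.inner hw)
  -- assemble
  have hG : ContinuousAt (fun q : 𝕋 ↦ (⟨q.proj, (mfderiv 𝓘(ℝ, 𝕎 2) (𝓡 (2 * 2)) (toCP (n := 2))
      (homLift (chartIndex q₀.proj) q.proj) (coeffAt (chartIndex q₀.proj) q),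
      ((‖homLift (chartIndex q₀.proj) q.proj‖ : ℂ) ^ 2)⁻¹ *
        ⟪homLift (chartIndex q₀.proj) q.proj, coeffAt (chartIndex q₀.proj) q⟫_ℂ)⟩ : 𝕍)) q₀ := by
    rw [(FiberBundle.Prod.isInducing_diag (𝔼 (2 * 2)) (TangentSpace (𝓡 (2 * 2)) : ComplexProjectiveSpace 2 → Type)
      ℂ (Bundle.Trivial (ComplexProjectiveSpace 2) ℂ)).continuousAt_iff]
    exact hT.prodMk hZ
  refine hG.congr ?_
  filter_upwards [hUq] with q hq
  exact (eulerTotal_eq hq).symm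

/-- **The Euler real vector bundle morphism `Tℂℙ² ⊕ ℂ → (γ¹)³` is continuous** (the inverse of a
continuous fibrewise-invertible morphism of real vector bundles, Husemoller Ch. 3 Thm. 2.5).
[cite: HusemollerFibreBundles1994, Ch. 3 Thm. 2.5] -/
theorem continuous_eulerTotal_symm :
    Continuous fun q : 𝕍 ↦ (⟨q.proj, (eulerEquiv q.proj).symm q.snd⟩ : 𝕋) :=
  Literature.Geometry.Symplectic.continuous_totalSpace_symm (𝕜 := ℝ) (F₁ := ℂ × (ℂ × ℂ)) (F₂ := 𝔼 (2 * 2) × ℂ)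
    (E₁ := fun p : ComplexProjectiveSpace 2 ↦ tautLine 2 p × (tautLine 2 p × tautLine 2 p))
    (E₂ := fun p : ComplexProjectiveSpace 2 ↦ TangentSpace (𝓡 (2 * 2)) p × Bundle.Trivial (ComplexProjectiveSpace 2) ℂ p)
    eulerEquiv continuous_eulerTotal

end EulerTotal


/-! ### `p₁(Tℂℙ²) = 3x²` -/

section Pontryagin

open Literature.AlgebraicTopology.CharacteristicClasses Literature.AlgebraicTopology.SingularHomology
open scoped LinearAlgebra.Projectivization

/-- **`c₂(ξ ⊕ η) = c₂(ξ) + c₁(ξ) ⌣ c₁(η) + c₂(η)`** (the Whitney sum formula (C₂) in degree `4`).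
[cite: HusemollerFibreBundles1994, Ch. 17 §3 (C₂)] -/
theorem chernClassZ_two_directSum {B : Type} [TopologicalSpace B] [T2Space B] [ParacompactSpace B]
    (E₁ E₂ : ComplexVectorBundle.{0, 0} B) :
    chernClassZ (E₁.directSum E₂) 2 =
      chernClassZ E₁ 2 + cupEven (show 1 + 1 = 2 from rfl) (chernClassZ E₁ 1) (chernClassZ E₂ 1) + chernClassZ E₂ 2 := by
  have h2 := theChernClassTheory.chernClass_directSum E₁ E₂ 2
  have hu : (Finset.univ : Finset (Finset.HasAntidiagonal.antidiagonal 2)) =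
      {⟨(0, 2), by simp⟩, ⟨(1, 1), by simp⟩, ⟨(2, 0), by simp⟩} := by decide
  rw [hu, Finset.sum_insert (by decide), Finset.sum_pair (by decide)] at h2
  refine h2.trans ?_
  change cupEven _ (chernClassZ _ 0) (chernClassZ _ 2) +
    (cupEven _ (chernClassZ _ 1) (chernClassZ _ 1) + cupEven _ (chernClassZ _ 2) (chernClassZ _ 0)) = _
  rw [chernClassZ_zero, chernClassZ_zero]
  have e1 : cupEven (show 0 + 2 = 2 from rfl) (singularCohomology.one ℤ B) (chernClassZ E₂ 2) = chernClassZ E₂ 2 :=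
    one_cupProduct _
  have e2 : cupEven (show 2 + 0 = 2 from rfl) (chernClassZ E₁ 2) (singularCohomology.one ℤ B) = chernClassZ E₁ 2 :=
    cupProduct_one _
  rw [e1, e2]
  abel

/-- **`c₁(ξ ⊕ η) = c₁(ξ) + c₁(η)`** for the integral classes. [cite: HusemollerFibreBundles1994, Ch. 17 §3 (C₂)] -/
theorem chernClassZ_one_directSum {B : Type} [TopologicalSpace B] [T2Space B] [ParacompactSpace B]
    (E₁ E₂ : ComplexVectorBundle.{0, 0} B) :
    chernClassZ (E₁.directSum E₂) 1 = chernClassZ E₁ 1 + chernClassZ E₂ 1 :=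
  theChernClassTheory.chernClass_one_directSum E₁ E₂

/-- **The sum of three copies of the tautological line bundle, `(γ¹)³ → ℂℙ²`.** [folklore] -/
abbrev tautLineBundle₃ : ComplexVectorBundle.{0, 0} (ComplexProjectiveSpace 2) :=
  (tautLineBundle 2).directSum ((tautLineBundle 2).directSum (tautLineBundle 2))

/-- `x = c₁(γ¹) ∈ H²(ℂℙ²; ℤ)`. [cite: MilnorStasheffAMS76, §14 Thm. 14.4] -/
abbrev xClassCP2 : singularCohomology ℤ ℤ (ComplexProjectiveSpace 2) 2 := chernClassZ (tautLineBundle 2) 1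

/-- `c₂(γ¹) = 0` (a line bundle). [folklore] -/
theorem chernClassZ_two_tautLineBundle : chernClassZ (tautLineBundle 2) 2 = 0 :=
  chernClassZ_eq_zero_of_rank_lt _ (by simp)

/-- `x² = x ⌣ x ∈ H⁴(ℂℙ²; ℤ)`. [cite: MilnorStasheffAMS76, §14 Thm. 14.4] -/
abbrev xSqClassCP2 : singularCohomology ℤ ℤ (ComplexProjectiveSpace 2) (2 * 2) :=
  cupEven (show 1 + 1 = 2 from rfl) xClassCP2 xClassCP2

/-- **`c₁((γ¹)³) = 3x`.** [cite: MilnorStasheffAMS76, §14 Thm. 14.10] -/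
theorem chernClassZ_one_tautLineBundle₃ : chernClassZ tautLineBundle₃ 1 = xClassCP2 + xClassCP2 + xClassCP2 := by
  rw [tautLineBundle₃, chernClassZ_one_directSum, chernClassZ_one_directSum]
  exact (add_assoc _ _ _).symm

/-- **`c₂((γ¹)³) = 3x²`.** [cite: MilnorStasheffAMS76, §14 Thm. 14.10] -/
theorem chernClassZ_two_tautLineBundle₃ : chernClassZ tautLineBundle₃ 2 = xSqClassCP2 + xSqClassCP2 + xSqClassCP2 := by
  rw [tautLineBundle₃, chernClassZ_two_directSum, chernClassZ_two_directSum, chernClassZ_one_directSum,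
    chernClassZ_two_tautLineBundle, map_add]
  change (0 : singularCohomology ℤ ℤ (ComplexProjectiveSpace 2) (2 * 2)) + (xSqClassCP2 + xSqClassCP2) +
    (0 + xSqClassCP2 + 0) = xSqClassCP2 + xSqClassCP2 + xSqClassCP2
  abel

/-- The real structure of the fibres of `(γ¹)³` (restriction of scalars). [folklore] -/
instance instModuleRealTautLineBundle₃ (p : ComplexProjectiveSpace 2) : Module ℝ (tautLineBundle₃.E p) :=
  inferInstanceAs (Module ℝ (tautLine 2 p × (tautLine 2 p × tautLine 2 p)))

/-- The real and complex structures of the fibres of `(γ¹)³` are compatible. [folklore] -/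
instance instIsScalarTowerTautLineBundle₃ (p : ComplexProjectiveSpace 2) : IsScalarTower ℝ ℂ (tautLineBundle₃.E p) :=
  inferInstanceAs (IsScalarTower ℝ ℂ (tautLine 2 p × (tautLine 2 p × tautLine 2 p)))

/-- Local notation: the total space of `(γ¹)³ → ℂℙ²`. -/
local notation "𝕋" => TotalSpace (ℂ × (ℂ × ℂ)) (fun p : ComplexProjectiveSpace 2 ↦ tautLine 2 p × (tautLine 2 p × tautLine 2 p))
/-- Local notation: the total space of `Tℂℙ² ⊕ ℂ`. -/
local notation "𝕍" => TotalSpace (𝔼 (2 * 2) × ℂ)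
  (fun p : ComplexProjectiveSpace 2 ↦ TangentSpace (𝓡 (2 * 2)) p × Bundle.Trivial (ComplexProjectiveSpace 2) ℂ p)

/-- **`p₁(Tℂℙ²) = 3 x²`** (Milnor–Stasheff Example 15.6 / Hirzebruch Thm. 4.10.2: `p(ℂℙⁿ) = (1 + x²)ⁿ⁺¹`,
so `p₁(ℂℙ²) = 3x²`, here written `x² + x² + x²`), from the real Euler isomorphism `Tℂℙ² ⊕ ℂ ≅_ℝ (γ¹)³` (`eulerEquiv`), the
stability `p₁(T ⊕ ε) = p₁(T)`, the realification formula `p₁(V) = c₁(E)² - 2c₂(E)` for `V ≅_ℝ E`,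
and `c((γ¹)³) = (1 + x)³`. [cite: MilnorStasheffAMS76, §15 Example 15.6] [cite: Hirzebruch1966, Thm. 4.10.2] -/
theorem tangentPontryaginClass_one_complexProjectiveSpace_two :
    degCast ℤ (show 4 * 1 = 4 by norm_num) (tangentPontryaginClass (𝓡 (2 * 2)) (ComplexProjectiveSpace 2) 1) =
      degCast ℤ (show 2 * 2 = 4 by norm_num) (xSqClassCP2 + xSqClassCP2 + xSqClassCP2) := by
  have hφ' : Continuous fun q : 𝕋 ↦ (⟨q.proj, ((eulerEquiv q.proj).symm).symm q.snd⟩ : 𝕍) := by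
    simp only [ContinuousLinearEquiv.symm_symm]
    exact continuous_eulerTotal
  have hreal := pontryaginClass_one_eq_of_realForm (𝔼 (2 * 2) × ℂ)
    (fun p : ComplexProjectiveSpace 2 ↦ TangentSpace (𝓡 (2 * 2)) p × Bundle.Trivial (ComplexProjectiveSpace 2) ℂ p)
    tautLineBundle₃ (fun p ↦ (eulerEquiv p).symm) continuous_eulerTotal_symm hφ'
  rw [pontryaginClass_prod_trivial, chernClassZ_one_tautLineBundle₃, chernClassZ_two_tautLineBundle₃] at hreal
  refine hreal.trans ?_
  congr 1
  simp only [map_add, LinearMap.add_apply]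
  change xSqClassCP2 + xSqClassCP2 + xSqClassCP2 + (xSqClassCP2 + xSqClassCP2 + xSqClassCP2) +
    (xSqClassCP2 + xSqClassCP2 + xSqClassCP2) - (2 : ℤ) • (xSqClassCP2 + xSqClassCP2 + xSqClassCP2) = _
  abel

end Pontryagin

end Literature.Geometry.Kaehler
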